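import Summits.Ventures.PercRepro.Night2SeriesTriangleCells

/-!
# PercRepro — `(3, 0)` at `|G| = 11` closes with `≤ 3` fat thin closures, `|G| = 12` with `≤ 4`; residues O
(night-2, gen 23)

With the budget WITH the face-sum constraint (`Night2FatBudgetFS`) and the triangle / three-disjoint counts:
at `n = 11`, `k = 3` (`fatBudgetFS = 106/405`): triangle `70713/69160 = 1.022`, three disjoint `1.055`; at `n = 12`,
`k = 4` (`11/45`): triangle `4271049/4184180 = 1.021` (three disjoint: gen 23's chord theorem).  Three fat thin
members with pairwise different missed pairs either share a point (series transitivity → the triangle) or are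
pairwise disjoint, so **`localShadowHall_three_zero_six_eleven_of_le_three`** (at most three fat thin closures) and
**`localShadowHall_three_zero_six_twelve_of_le_four`** close, and **`shadowHall_seven_five_of_residuesO`** carries the
clauses «at least `4` / `5` fat thin closures» at `|G| = 11 / 12`.
-/

namespace PercRepro.Shadow

open Finset PerFlat ThmH

/-- The chord of `1/(m + 3)` on `3 ≤ m ≤ 6` (`n = 11` at `(3, 0)`): `1/(m+3) ≤ 2/9 − m/54`. -/
theorem chord3_three_zero_11 : ∀ m : ℕ, 3 ≤ m → m ≤ 6 →
    1 / ((m : ℚ) + ((3 : ℕ) : ℚ)) ≤ (2 / 9 : ℚ) - (1 / 54 : ℚ) * (m : ℚ) := by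
  intro m h1 h2
  interval_cases m <;> norm_num

/-- `fatBudgetFS 5 3 6 3 11 (2/9) (1/54) = 106/405`. -/
theorem fatBudgetFS_three_zero_eleven_three : fatBudgetFS 5 3 6 3 11 (2 / 9 : ℚ) (1 / 54 : ℚ) = (106 / 405 : ℚ) := by
  unfold fatBudgetFS capDG phiQ; norm_num

/-- `fatBudgetFS 5 3 6 4 12 (13/60) (1/60) = 11/45`. -/
theorem fatBudgetFS_three_zero_twelve_four : fatBudgetFS 5 3 6 4 12 (13 / 60 : ℚ) (1 / 60 : ℚ) = (11 / 45 : ℚ) := by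
  unfold fatBudgetFS capDG phiQ; norm_num

/-- The count sum of the cell `(3, 0)` at `n = 11` with the count `cntTriangle` and the fatBudget `E = 106 / 405`: `1.022 ≥ 1`. -/
theorem countSum_three_zero_eleven_tri_b3 :
    1 ≤ countSum 11 6 3 (cPrimeDGP 5 3 6 0 2) (106 / 405 : ℚ) (cntTriangle 6) := by
  rw [cPrimeDGP_three_zero_two]
  unfold countSum DGenP.cjG cntTriangle
  rw [show Finset.Icc 1 (11 - 6) = {1, 2, 3, 4, 5} by decide]
  repeat rw [Finset.sum_insert (by decide)]
  rw [Finset.sum_singleton]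
  norm_num [Nat.choose_eq_descFactorial_div_factorial, Nat.descFactorial, Nat.factorial]

/-- The count sum of the cell `(3, 0)` at `n = 11` with the count `cntDisjThree` and the fatBudget `E = 106 / 405`: `1.055 ≥ 1`. -/
theorem countSum_three_zero_eleven_d3_b3 :
    1 ≤ countSum 11 6 3 (cPrimeDGP 5 3 6 0 2) (106 / 405 : ℚ) (cntDisjThree 6) := by
  rw [cPrimeDGP_three_zero_two]
  unfold countSum DGenP.cjG cntDisjThree
  rw [show Finset.Icc 1 (11 - 6) = {1, 2, 3, 4, 5} by decide]
  repeat rw [Finset.sum_insert (by decide)]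
  rw [Finset.sum_singleton]
  norm_num [Nat.choose_eq_descFactorial_div_factorial, Nat.descFactorial, Nat.factorial]

/-- The count sum of the cell `(3, 0)` at `n = 12` with the count `cntTriangle` and the fatBudget `E = 11 / 45`: `1.021 ≥ 1`. -/
theorem countSum_three_zero_twelve_tri_b4 :
    1 ≤ countSum 12 6 3 (cPrimeDGP 5 3 6 0 2) (11 / 45 : ℚ) (cntTriangle 6) := by
  rw [cPrimeDGP_three_zero_two]
  unfold countSum DGenP.cjG cntTriangle
  rw [show Finset.Icc 1 (12 - 6) = {1, 2, 3, 4, 5, 6} by decide]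
  repeat rw [Finset.sum_insert (by decide)]
  rw [Finset.sum_singleton]
  norm_num [Nat.choose_eq_descFactorial_div_factorial, Nat.descFactorial, Nat.factorial]

variable {α : Type*} [DecidableEq α] {M : Matroid α} [M.Finite]

open scoped Classical in
/-- **The cell `(3, 0)` at `|G| = 11` with two fat thin members whose missed pairs share a point and at most 3 fat thin
closures**: (LI_G) through series transitivity, the triangle count and the fatBudget `106 / 405`. -/
theorem localShadowHall_three_zero_six_eleven_of_triangle_b3 {G : Finset α} (hG : G ∈ flatsQ M (5 + 1))
    (hd : (gr M \ G).card = 3) (hk : kColoops M G = 0)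
    (hs : ∀ e ∈ gr M, ∀ f ∈ gr M, e ≠ f → rkN M {e, f} = 2) (hl : ∀ e ∈ gr M, M.Indep {e})
    (hn : G.card = 11) {B₀ B₁ : Finset α} (hB₀ : B₀ ∈ thinMembers M 5 G) (hB₁ : B₁ ∈ thinMembers M 5 G)
    {p x y : α} (hP₀ : G \ clF M B₀ = {p, x}) (hP₁ : G \ clF M B₁ = {p, y})
    (hpx : p ≠ x) (hpy : p ≠ y) (hxy : x ≠ y) (hcl : (fatClosures M 5 G 2).card ≤ 3) :
    LocalShadowHall M 5 G := by
  have hk' : kColoops M G + 6 = 5 + 1 := by omega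
  have hd' : (gr M \ G).card ≤ 5 := by omega
  have hm2 : ∀ B ∈ thinMembers M 5 G, 6 ≤ (B \ coloops M G).card → 2 ≤ (G \ clF M B).card :=
    fun B hB _ => two_le_card_sdiff_of_not_lay0 hG hd' (mem_thinMembers.1 hB).1 (mem_thinMembers.1 hB).2
  have hc2 : 0 ≤ cPrimeDGP 5 3 6 (kColoops M G) 2 := by
    rw [hk]; unfold cPrimeDGP capDG reqDGP phiQ; norm_num
  have hn' : G.card - kColoops M G = 11 := by omega
  have hKG : coloops M G ⊆ G := fun y hy => (mem_coloops.1 hy).1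
  have hnK : (G \ coloops M G).card = 11 := by
    rw [Finset.card_sdiff_of_subset hKG, ← kColoops_eq_card_coloops]; omega
  have hKempty : coloops M G = ∅ := by
    rw [kColoops_eq_card_coloops] at hk
    exact Finset.card_eq_zero.1 hk
  have hH₀ := eRk_clF_le_of_mem_thinMembers hB₀
  have hH₁ := eRk_clF_le_of_mem_thinMembers hB₁
  have hH₂ : M.eRk ((G \ {x, y} : Finset α) : Set α) ≤ ((5 : ℕ) : ℕ∞) :=
    eRk_sdiff_pair_le_of_series hG hk hH₀ hH₁ hP₀ hP₁ hpx hpy hxy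
  have hxG : x ∈ G := by
    have : x ∈ G \ clF M B₀ := by rw [hP₀]; simp
    exact (Finset.mem_sdiff.1 this).1
  have hyG : y ∈ G := by
    have : y ∈ G \ clF M B₁ := by rw [hP₁]; simp
    exact (Finset.mem_sdiff.1 this).1
  have hP₂ : G \ (G \ {x, y}) = {x, y} :=
    Finset.sdiff_sdiff_eq_self (Finset.insert_subset hxG (Finset.singleton_subset_iff.2 hyG))
  have hK₂ : coloops M G ⊆ G \ {x, y} := by rw [hKempty]; exact Finset.empty_subset _
  refine localShadowHall_excess_of_count (d := 3) (ρ := 6) (m₁ := 2) hG hd (by norm_num) hk' (by norm_num)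
    hs hl hc2 hm2 (E := (106 / 405 : ℚ)) (by norm_num) ?_ (cnt := cntTriangle 6) ?_ ?_ ?_
  · intro S _ T hT
    have hT' : T ∈ (S \ coloops M G).powersetCard 6 := by
      unfold coverBases at hT
      exact (Finset.mem_filter.1 hT).1
    have h := sum_faceLoss_budgetFS_union_le (k := 3) (a := (2 / 9 : ℚ)) (b := (1 / 54 : ℚ)) hG hd
      (by norm_num) hk' hk (by norm_num) hs hl (by norm_num) (by rw [hnK]; norm_num)
      (by rw [hnK]; intro m h1 h2; exact chord3_three_zero_11 m h1 (by omega)) (by norm_num)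
      (by rw [hnK, fatBudgetFS_three_zero_eleven_three]; norm_num) hcl hT'
    rw [hnK, fatBudgetFS_three_zero_eleven_three] at h
    exact h
  · intro s h1 h2
    rw [hn'] at h2
    exact cntTriangle_six_pos s h1 (by omega)
  · intro S hSG
    exact card_coverBases_le_cntTriangle hk' (by norm_num) (coloops_subset_clF_of_mem_thinMembers hG hd' hB₀)
      hH₀ (coloops_subset_clF_of_mem_thinMembers hG hd' hB₁) hH₁ hK₂ hH₂ hP₀ hP₁ hP₂ hpx hpy hxy hSG
  · rw [hn', hk]
    exact countSum_three_zero_eleven_tri_b3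

open scoped Classical in
/-- **The cell `(3, 0)` at `|G| = 11` with three fat thin members missing pairwise DISJOINT sets and at most 3 fat
thin closures**: (LI_G) through the three-disjoint count and the fatBudget `106 / 405`. -/
theorem localShadowHall_three_zero_six_eleven_of_threeDisjoint_b3 {G : Finset α} (hG : G ∈ flatsQ M (5 + 1))
    (hd : (gr M \ G).card = 3) (hk : kColoops M G = 0)
    (hs : ∀ e ∈ gr M, ∀ f ∈ gr M, e ≠ f → rkN M {e, f} = 2) (hl : ∀ e ∈ gr M, M.Indep {e})
    (hn : G.card = 11) {B₀ B₁ B₂ : Finset α} (hB₀ : B₀ ∈ thinMembers M 5 G) (hB₁ : B₁ ∈ thinMembers M 5 G)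
    (hB₂ : B₂ ∈ thinMembers M 5 G)
    (hfat₀ : (G \ clF M B₀).card ≤ 2) (hfat₁ : (G \ clF M B₁).card ≤ 2) (hfat₂ : (G \ clF M B₂).card ≤ 2)
    (hd₀₁ : (G \ clF M B₀) ∩ (G \ clF M B₁) = ∅) (hd₀₂ : (G \ clF M B₀) ∩ (G \ clF M B₂) = ∅)
    (hd₁₂ : (G \ clF M B₁) ∩ (G \ clF M B₂) = ∅) (hcl : (fatClosures M 5 G 2).card ≤ 3) :
    LocalShadowHall M 5 G := by
  have hk' : kColoops M G + 6 = 5 + 1 := by omega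
  have hd' : (gr M \ G).card ≤ 5 := by omega
  have hm2 : ∀ B ∈ thinMembers M 5 G, 6 ≤ (B \ coloops M G).card → 2 ≤ (G \ clF M B).card :=
    fun B hB _ => two_le_card_sdiff_of_not_lay0 hG hd' (mem_thinMembers.1 hB).1 (mem_thinMembers.1 hB).2
  have hc2 : 0 ≤ cPrimeDGP 5 3 6 (kColoops M G) 2 := by
    rw [hk]; unfold cPrimeDGP capDG reqDGP phiQ; norm_num
  have hn' : G.card - kColoops M G = 11 := by omega
  have hKG : coloops M G ⊆ G := fun y hy => (mem_coloops.1 hy).1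
  have hnK : (G \ coloops M G).card = 11 := by
    rw [Finset.card_sdiff_of_subset hKG, ← kColoops_eq_card_coloops]; omega
  refine localShadowHall_excess_of_count (d := 3) (ρ := 6) (m₁ := 2) hG hd (by norm_num) hk' (by norm_num)
    hs hl hc2 hm2 (E := (106 / 405 : ℚ)) (by norm_num) ?_ (cnt := cntDisjThree 6) ?_ ?_ ?_
  · intro S _ T hT
    have hT' : T ∈ (S \ coloops M G).powersetCard 6 := by
      unfold coverBases at hT
      exact (Finset.mem_filter.1 hT).1
    have h := sum_faceLoss_budgetFS_union_le (k := 3) (a := (2 / 9 : ℚ)) (b := (1 / 54 : ℚ)) hG hd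
      (by norm_num) hk' hk (by norm_num) hs hl (by norm_num) (by rw [hnK]; norm_num)
      (by rw [hnK]; intro m h1 h2; exact chord3_three_zero_11 m h1 (by omega)) (by norm_num)
      (by rw [hnK, fatBudgetFS_three_zero_eleven_three]; norm_num) hcl hT'
    rw [hnK, fatBudgetFS_three_zero_eleven_three] at h
    exact h
  · intro s h1 h2
    rw [hn'] at h2
    exact cntDisjThree_six_pos s h1 (by omega)
  · intro S hSG
    exact card_coverBases_le_cntDisjThree hk' (by norm_num) (coloops_subset_clF_of_mem_thinMembers hG hd' hB₀)
      (eRk_clF_le_of_mem_thinMembers hB₀) (coloops_subset_clF_of_mem_thinMembers hG hd' hB₁)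
      (eRk_clF_le_of_mem_thinMembers hB₁) (coloops_subset_clF_of_mem_thinMembers hG hd' hB₂)
      (eRk_clF_le_of_mem_thinMembers hB₂) hfat₀ hfat₁ hfat₂ hd₀₁ hd₀₂ hd₁₂ hSG
  · rw [hn', hk]
    exact countSum_three_zero_eleven_d3_b3

open scoped Classical in
/-- **The cell `(3, 0)` at `|G| = 12` with two fat thin members whose missed pairs share a point and at most 4 fat thin
closures**: (LI_G) through series transitivity, the triangle count and the fatBudget `11 / 45`. -/
theorem localShadowHall_three_zero_six_twelve_of_triangle_b4 {G : Finset α} (hG : G ∈ flatsQ M (5 + 1))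
    (hd : (gr M \ G).card = 3) (hk : kColoops M G = 0)
    (hs : ∀ e ∈ gr M, ∀ f ∈ gr M, e ≠ f → rkN M {e, f} = 2) (hl : ∀ e ∈ gr M, M.Indep {e})
    (hn : G.card = 12) {B₀ B₁ : Finset α} (hB₀ : B₀ ∈ thinMembers M 5 G) (hB₁ : B₁ ∈ thinMembers M 5 G)
    {p x y : α} (hP₀ : G \ clF M B₀ = {p, x}) (hP₁ : G \ clF M B₁ = {p, y})
    (hpx : p ≠ x) (hpy : p ≠ y) (hxy : x ≠ y) (hcl : (fatClosures M 5 G 2).card ≤ 4) :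
    LocalShadowHall M 5 G := by
  have hk' : kColoops M G + 6 = 5 + 1 := by omega
  have hd' : (gr M \ G).card ≤ 5 := by omega
  have hm2 : ∀ B ∈ thinMembers M 5 G, 6 ≤ (B \ coloops M G).card → 2 ≤ (G \ clF M B).card :=
    fun B hB _ => two_le_card_sdiff_of_not_lay0 hG hd' (mem_thinMembers.1 hB).1 (mem_thinMembers.1 hB).2
  have hc2 : 0 ≤ cPrimeDGP 5 3 6 (kColoops M G) 2 := by
    rw [hk]; unfold cPrimeDGP capDG reqDGP phiQ; norm_num
  have hn' : G.card - kColoops M G = 12 := by omega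
  have hKG : coloops M G ⊆ G := fun y hy => (mem_coloops.1 hy).1
  have hnK : (G \ coloops M G).card = 12 := by
    rw [Finset.card_sdiff_of_subset hKG, ← kColoops_eq_card_coloops]; omega
  have hKempty : coloops M G = ∅ := by
    rw [kColoops_eq_card_coloops] at hk
    exact Finset.card_eq_zero.1 hk
  have hH₀ := eRk_clF_le_of_mem_thinMembers hB₀
  have hH₁ := eRk_clF_le_of_mem_thinMembers hB₁
  have hH₂ : M.eRk ((G \ {x, y} : Finset α) : Set α) ≤ ((5 : ℕ) : ℕ∞) :=
    eRk_sdiff_pair_le_of_series hG hk hH₀ hH₁ hP₀ hP₁ hpx hpy hxy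
  have hxG : x ∈ G := by
    have : x ∈ G \ clF M B₀ := by rw [hP₀]; simp
    exact (Finset.mem_sdiff.1 this).1
  have hyG : y ∈ G := by
    have : y ∈ G \ clF M B₁ := by rw [hP₁]; simp
    exact (Finset.mem_sdiff.1 this).1
  have hP₂ : G \ (G \ {x, y}) = {x, y} :=
    Finset.sdiff_sdiff_eq_self (Finset.insert_subset hxG (Finset.singleton_subset_iff.2 hyG))
  have hK₂ : coloops M G ⊆ G \ {x, y} := by rw [hKempty]; exact Finset.empty_subset _
  refine localShadowHall_excess_of_count (d := 3) (ρ := 6) (m₁ := 2) hG hd (by norm_num) hk' (by norm_num)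
    hs hl hc2 hm2 (E := (11 / 45 : ℚ)) (by norm_num) ?_ (cnt := cntTriangle 6) ?_ ?_ ?_
  · intro S _ T hT
    have hT' : T ∈ (S \ coloops M G).powersetCard 6 := by
      unfold coverBases at hT
      exact (Finset.mem_filter.1 hT).1
    have h := sum_faceLoss_budgetFS_union_le (k := 4) (a := (13 / 60 : ℚ)) (b := (1 / 60 : ℚ)) hG hd
      (by norm_num) hk' hk (by norm_num) hs hl (by norm_num) (by rw [hnK]; norm_num)
      (by rw [hnK]; intro m h1 h2; exact chord3_three_zero_12 m h1 (by omega)) (by norm_num)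
      (by rw [hnK, fatBudgetFS_three_zero_twelve_four]; norm_num) hcl hT'
    rw [hnK, fatBudgetFS_three_zero_twelve_four] at h
    exact h
  · intro s h1 h2
    rw [hn'] at h2
    exact cntTriangle_six_pos s h1 (by omega)
  · intro S hSG
    exact card_coverBases_le_cntTriangle hk' (by norm_num) (coloops_subset_clF_of_mem_thinMembers hG hd' hB₀)
      hH₀ (coloops_subset_clF_of_mem_thinMembers hG hd' hB₁) hH₁ hK₂ hH₂ hP₀ hP₁ hP₂ hpx hpy hxy hSG
  · rw [hn', hk]
    exact countSum_three_zero_twelve_tri_b4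

open scoped Classical in
/-- **The cell `(3, 0)` at `|G| = 11` with at most THREE fat thin closures** (given a fat thin member). -/
theorem localShadowHall_three_zero_six_eleven_of_le_three {G : Finset α} (hG : G ∈ flatsQ M (5 + 1))
    (hd : (gr M \ G).card = 3) (hk : kColoops M G = 0)
    (hs : ∀ e ∈ gr M, ∀ f ∈ gr M, e ≠ f → rkN M {e, f} = 2) (hl : ∀ e ∈ gr M, M.Indep {e})
    (hn : G.card = 11) {B₀ : Finset α} (hB₀ : B₀ ∈ thinMembers M 5 G) (hfat : (G \ clF M B₀).card ≤ 2)
    (hcl : (fatClosures M 5 G 2).card ≤ 3) :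
    LocalShadowHall M 5 G := by
  have hd' : (gr M \ G).card ≤ 5 := by omega
  by_cases h1 : (fatClosures M 5 G 2).card ≤ 1
  · exact localShadowHall_three_zero_six_eleven_of_oneFatClosure hG hd hk hs hl hn hB₀ hfat h1
  by_cases h2 : (fatClosures M 5 G 2).card ≤ 2
  · push Not at h1
    obtain ⟨B₀', hB₀', B₁, hB₁, hf₀, hf₁, hne⟩ := exists_twoFat_of_one_lt_card_fatClosures h1
    exact localShadowHall_three_zero_six_eleven_of_twoFat_b2 hG hd hk hs hl hn hB₀' hB₁ hf₀ hf₁ hne h2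
  push Not at h2
  obtain ⟨B₀', hB₀', B₁, hB₁, B₂, hB₂, hf₀, hf₁, hf₂, h01, h02, h12⟩ :=
    exists_threeFat_of_two_lt_card_fatClosures (M := M) (q := 5) (G := G) h2
  have hc : ∀ {B : Finset α}, B ∈ thinMembers M 5 G → (G \ clF M B).card ≤ 2 → (G \ clF M B).card = 2 :=
    fun hB hle => le_antisymm hle
      (two_le_card_sdiff_of_not_lay0 hG hd' (mem_thinMembers.1 hB).1 (mem_thinMembers.1 hB).2)
  by_cases hshare : ((G \ clF M B₀') ∩ (G \ clF M B₁)).Nonempty ∨ ((G \ clF M B₀') ∩ (G \ clF M B₂)).Nonempty ∨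
      ((G \ clF M B₁) ∩ (G \ clF M B₂)).Nonempty
  · rcases hshare with ⟨p, hp⟩ | ⟨p, hp⟩ | ⟨p, hp⟩
    · obtain ⟨x, y, hP₀, hP₁, hpx, hpy, hxy⟩ := pair_shape_of_mem_inter (hc hB₀' hf₀) (hc hB₁ hf₁) h01 hp
      exact localShadowHall_three_zero_six_eleven_of_triangle_b3 hG hd hk hs hl hn hB₀' hB₁ hP₀ hP₁ hpx hpy hxy hcl
    · obtain ⟨x, y, hP₀, hP₁, hpx, hpy, hxy⟩ := pair_shape_of_mem_inter (hc hB₀' hf₀) (hc hB₂ hf₂) h02 hp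
      exact localShadowHall_three_zero_six_eleven_of_triangle_b3 hG hd hk hs hl hn hB₀' hB₂ hP₀ hP₁ hpx hpy hxy hcl
    · obtain ⟨x, y, hP₀, hP₁, hpx, hpy, hxy⟩ := pair_shape_of_mem_inter (hc hB₁ hf₁) (hc hB₂ hf₂) h12 hp
      exact localShadowHall_three_zero_six_eleven_of_triangle_b3 hG hd hk hs hl hn hB₁ hB₂ hP₀ hP₁ hpx hpy hxy hcl
  · push Not at hshare
    obtain ⟨hd₀₁, hd₀₂, hd₁₂⟩ := hshare
    exact localShadowHall_three_zero_six_eleven_of_threeDisjoint_b3 hG hd hk hs hl hn hB₀' hB₁ hB₂ hf₀ hf₁ hf₂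
      hd₀₁ hd₀₂ hd₁₂ hcl

open scoped Classical in
/-- **The cell `(3, 0)` at `|G| = 12` with at most FOUR fat thin closures** (given a fat thin member). -/
theorem localShadowHall_three_zero_six_twelve_of_le_four {G : Finset α} (hG : G ∈ flatsQ M (5 + 1))
    (hd : (gr M \ G).card = 3) (hk : kColoops M G = 0)
    (hs : ∀ e ∈ gr M, ∀ f ∈ gr M, e ≠ f → rkN M {e, f} = 2) (hl : ∀ e ∈ gr M, M.Indep {e})
    (hn : G.card = 12) {B₀ : Finset α} (hB₀ : B₀ ∈ thinMembers M 5 G) (hfat : (G \ clF M B₀).card ≤ 2)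
    (hcl : (fatClosures M 5 G 2).card ≤ 4) :
    LocalShadowHall M 5 G := by
  have hd' : (gr M \ G).card ≤ 5 := by omega
  by_cases h1 : (fatClosures M 5 G 2).card ≤ 1
  · exact localShadowHall_three_zero_six_twelve_of_oneFatClosure hG hd hk hs hl hn hB₀ hfat h1
  by_cases h3 : (fatClosures M 5 G 2).card ≤ 3
  · push Not at h1
    obtain ⟨B₀', hB₀', B₁, hB₁, hf₀, hf₁, hne⟩ := exists_twoFat_of_one_lt_card_fatClosures h1
    exact localShadowHall_three_zero_six_twelve_of_twoFat_b3FS hG hd hk hs hl hn hB₀' hB₁ hf₀ hf₁ hne h3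
  push Not at h3
  obtain ⟨B₀', hB₀', B₁, hB₁, B₂, hB₂, hf₀, hf₁, hf₂, h01, h02, h12⟩ :=
    exists_threeFat_of_two_lt_card_fatClosures (M := M) (q := 5) (G := G) (by omega)
  have hc : ∀ {B : Finset α}, B ∈ thinMembers M 5 G → (G \ clF M B).card ≤ 2 → (G \ clF M B).card = 2 :=
    fun hB hle => le_antisymm hle
      (two_le_card_sdiff_of_not_lay0 hG hd' (mem_thinMembers.1 hB).1 (mem_thinMembers.1 hB).2)
  by_cases hshare : ((G \ clF M B₀') ∩ (G \ clF M B₁)).Nonempty ∨ ((G \ clF M B₀') ∩ (G \ clF M B₂)).Nonempty ∨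
      ((G \ clF M B₁) ∩ (G \ clF M B₂)).Nonempty
  · rcases hshare with ⟨p, hp⟩ | ⟨p, hp⟩ | ⟨p, hp⟩
    · obtain ⟨x, y, hP₀, hP₁, hpx, hpy, hxy⟩ := pair_shape_of_mem_inter (hc hB₀' hf₀) (hc hB₁ hf₁) h01 hp
      exact localShadowHall_three_zero_six_twelve_of_triangle_b4 hG hd hk hs hl hn hB₀' hB₁ hP₀ hP₁ hpx hpy hxy hcl
    · obtain ⟨x, y, hP₀, hP₁, hpx, hpy, hxy⟩ := pair_shape_of_mem_inter (hc hB₀' hf₀) (hc hB₂ hf₂) h02 hp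
      exact localShadowHall_three_zero_six_twelve_of_triangle_b4 hG hd hk hs hl hn hB₀' hB₂ hP₀ hP₁ hpx hpy hxy hcl
    · obtain ⟨x, y, hP₀, hP₁, hpx, hpy, hxy⟩ := pair_shape_of_mem_inter (hc hB₁ hf₁) (hc hB₂ hf₂) h12 hp
      exact localShadowHall_three_zero_six_twelve_of_triangle_b4 hG hd hk hs hl hn hB₁ hB₂ hP₀ hP₁ hpx hpy hxy hcl
  · push Not at hshare
    obtain ⟨hd₀₁, hd₀₂, hd₁₂⟩ := hshare
    exact localShadowHall_three_zero_six_twelve_of_threeDisjoint hG hd hk hs hl hn hB₀' hB₁ hB₂ hf₀ hf₁ hf₂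
      hd₀₁ hd₀₂ hd₁₂

section SevenFiveO

variable {α' : Type} [DecidableEq α']

/-- **THE `(7, 5)` SHADOW ROW FOR EVERY FINITE MATROID MODULO THE RESIDUES O**: the residues N with the clauses at
`(3, 0)` raised to «at least `4` fat thin closures» at `|G| = 11` and «at least `5`» at `|G| = 12`. -/
theorem shadowHall_seven_five_of_residuesO
    (h20 : ∀ (N : Matroid α') [N.Finite] (G : Finset α'), CellHyp N G →
      (gr N \ G).card = 2 → kColoops N G = 0 → FatMember N G 6 3 →
      (FatBasis N G 6 2 ∨ FatMember N G 6 2) → LocalShadowHall N 5 G)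
    (h21 : ∀ (N : Matroid α') [N.Finite] (G : Finset α'), CellHyp N G →
      (gr N \ G).card = 2 → kColoops N G = 1 → FatMember N G 5 4 →
      (FatBasis N G 5 3 ∨ FatMember N G 5 3) → LocalShadowHall N 5 G)
    (h30 : ∀ (N : Matroid α') [N.Finite] (G : Finset α'), CellHyp N G →
      (gr N \ G).card = 3 → kColoops N G = 0 → 11 ≤ G.card → G.card ≤ 12 → FatMember N G 6 2 →
      FatBasis N G 6 2 → (G.card = 12 → NoThreeDisjointFat N G 2) → (G.card = 11 → NoFourDisjointFat N G 2) →
      (G.card = 11 → 4 ≤ (fatClosures N 5 G 2).card) → (G.card = 12 → 5 ≤ (fatClosures N 5 G 2).card) →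
      LocalShadowHall N 5 G)
    (h31 : ∀ (N : Matroid α') [N.Finite] (G : Finset α'), CellHyp N G →
      (gr N \ G).card = 3 → kColoops N G = 1 → 11 ≤ G.card → G.card ≤ 17 → FatMember N G 5 2 →
      (G.card = 17 → FatBasis N G 5 2) → (G.card = 17 → NestedFat N G 2 3) →
      (G.card = 16 → MeetingFat N G 2) → (11 ≤ G.card ∧ G.card ≤ 17 → NoThreeDisjointFat N G 2) →
      (G.card = 11 ∨ G.card = 15 ∨ G.card = 16 → FatBasis N G 5 3) →
      (12 ≤ G.card ∧ G.card ≤ 14 → FatBasis N G 5 4) → LocalShadowHall N 5 G)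
    (h32 : ∀ (N : Matroid α') [N.Finite] (G : Finset α'), CellHyp N G →
      (gr N \ G).card = 3 → kColoops N G = 2 → FatMember N G 4 2 → LocalShadowHall N 5 G)
    (M : Matroid α') [M.Finite] : ShadowHall M 7 5 (phiK 7 5) := by
  apply shadowHall_seven_five_of_residuesN h20 h21 _ h31 h32
  intro N _ G hcell hd hk h11 h12 hfm hfb hnd3 hnd4 hc11 hc12
  have hfm' := hfm
  obtain ⟨B₀, hB₀, -, hfat⟩ := hfm'
  by_cases hG11 : G.card = 11
  · by_cases hfour : 4 ≤ (fatClosures N 5 G 2).card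
    · exact h30 N G hcell hd hk h11 h12 hfm hfb hnd3 hnd4 (fun _ => hfour) (fun h => absurd h (by omega))
    · push Not at hfour
      exact localShadowHall_three_zero_six_eleven_of_le_three hcell.2.2.2 hd hk hcell.1 hcell.2.1 hG11 hB₀ hfat
        (by omega)
  · have hG12 : G.card = 12 := by omega
    by_cases hfive : 5 ≤ (fatClosures N 5 G 2).card
    · exact h30 N G hcell hd hk h11 h12 hfm hfb hnd3 hnd4 (fun h => absurd h hG11) (fun _ => hfive)
    · push Not at hfive
      exact localShadowHall_three_zero_six_twelve_of_le_four hcell.2.2.2 hd hk hcell.1 hcell.2.1 hG12 hB₀ hfat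
        (by omega)

end SevenFiveO

end PercRepro.Shadow
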